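import Summits.CriticalPhenomena.PercolationContinuityZ3.Theorems.PercNearOneGluingNoHeavyLowerTailThreePartitionOneOrPatterns
import Literature.Probability.Percolation.FoldingFibresHarris
import HarnessLib.Audit

/-!
# `NoHeavyLowerTail` (crux stmt-CriticalPhenomena-4575), master-family hierarchy P3 (gen 37): the QUANTITATIVE BASE INEQUALITY (♥)
# of the one-disjunction theorem — Kleitman slacks on the sub-cubes of `Q`, the singleton lemma, and the diagonal majorant `K*`

Support file (seat `prim-masterthm-p3`; `--supports stmt-CriticalPhenomena-4575`; memo
`run/shared/lean/prim/prim-masterthm/FROM-prim-masterthm-p3-g37-ONE-DISJUNCTION.md` §4–§5).  Pure finite-cube combinatorics about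
two up-sets `𝔄, 𝔅 ⊆ Set ι` seen through the sub-cube `2^Q` (`Q : Set ι`); no configurations of `ι` appear here.
* `klCube 𝔄 𝔅 F = #{a ⊆ F : a ∈ 𝔄 ∩ 𝔅} − #{a ⊆ F : a ∈ 𝔄, F \ a ∈ 𝔅} ≥ 0` (Kleitman–Harris on the cube `2^F`, from the tree's
  `FoldingFibre.fibreCount_le_of_isUpperSet`), and the SINGLETON LEMMA `one_le_klCube`: `≥ 1` as soon as some `{t} ∈ 𝔄 ∩ 𝔅` with
  `t ∈ F` and `∅ ∉ 𝔄 ∪ 𝔅` (`klCube = #{a ⊆ F \ {t} : a ∉ 𝔄, a ∉ 𝔅}`).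
* pattern DOUBLE SUMS `patSum Q f = Σ_{u ⊆ Q} Σ_{a ⊆ Q∖u} f u a` over (first part, third part) with `sum_cfgsIn_eq_patSum` (from the
  Q-patterns of `…OneOrPatterns`), `patSum_comm` (parts 1 ↔ 3) and the reflection `sum_subsetsOf_reflect` (parts 2 ↔ 3);
* the weights: `wPat` (`W`, the two-copy weight `Σ_P ([P₂≠∅]+[P₃≠∅]−[P₁≠∅])[P₂∈𝔄][P₃∈𝔅]`), `wdiag`/`phiPat` (`φ`, the one-copy budget),
  the discount `delta Q t = #{u ⊆ Q nonempty whose chosen element is t}` (`sum_delta`, `delta_le`), `mu = wdiag − [a={t}]δ_t ≥ 0`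
  (`mu_nonneg`) and the DIAGONAL MAJORANT `kStar` (`K*(𝔄,𝔅) = Σ_{a≠∅, a∈𝔄∩𝔅} μ(a)`).
The two pointwise inequalities (♥) `W ≤ K*` and (b) `K*(𝔇,𝔇) ≤ φ(𝔇)` are proved in the companion `…ThreePartitionOneOrHeart`.
HONEST LABEL: elementary counting; nothing bears on the (closed) crux. [this work]
-/

noncomputable section

open Finset
open scoped symmDiff Classical

namespace Summit.CriticalPhenomena.PercolationContinuityZ3.Theorems.ThreePartition

open Literature.Probability.Percolation (FoldingFibre.fibreCount_le_of_isUpperSet)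

variable {ι : Type*} [Fintype ι]

/-! ## Sub-cubes and the Kleitman slack -/

/-- The subsets of `F`, as a finset of sets. [this work] -/
def subsetsOf (F : Set ι) : Finset (Set ι) := univ.filter fun a => a ⊆ F

/-- Membership in `subsetsOf`. [this work] -/
@[simp] theorem mem_subsetsOf {F a : Set ι} : a ∈ subsetsOf F ↔ a ⊆ F := by
  unfold subsetsOf; simp only [mem_filter, mem_univ, true_and]

/-- The KLEITMAN SLACK of `(𝔄, 𝔅)` on the cube `2^F`: `#{a ⊆ F : a ∈ 𝔄 ∩ 𝔅} − #{a ⊆ F : a ∈ 𝔄, F \ a ∈ 𝔅}`. [this work] -/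
def klCube (𝔄 𝔅 : Set (Set ι)) (F : Set ι) : ℤ :=
  (((subsetsOf F).filter fun a => a ∈ 𝔄 ∧ a ∈ 𝔅).card : ℤ) - ((subsetsOf F).filter fun a => a ∈ 𝔄 ∧ F \ a ∈ 𝔅).card

omit [Fintype ι] in
/-- For `a ⊆ F`, `a ∆ F = F \ a`. [folklore] -/
theorem symmDiff_eq_sdiff_of_subset {a F : Set ι} (h : a ⊆ F) : a ∆ F = F \ a := by
  rw [Set.symmDiff_def, Set.sdiff_eq_empty.2 h, Set.empty_union]

/-- **Kleitman–Harris on a sub-cube**: `klCube 𝔄 𝔅 F ≥ 0` for up-sets `𝔄, 𝔅`. [this work] -/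
theorem klCube_nonneg {𝔄 𝔅 : Set (Set ι)} (h𝔄 : IsUpperSet 𝔄) (h𝔅 : IsUpperSet 𝔅) (F : Set ι) : 0 ≤ klCube 𝔄 𝔅 F := by
  have h := FoldingFibre.fibreCount_le_of_isUpperSet h𝔄 h𝔅 F ∅
  have e1 : (univ.filter fun a : Set ι => a \ F = ∅ ∧ a ∈ 𝔄 ∧ a ∆ F ∈ 𝔅) =
      (subsetsOf F).filter fun a => a ∈ 𝔄 ∧ F \ a ∈ 𝔅 := by
    ext a
    simp only [mem_filter, mem_univ, true_and, mem_subsetsOf, Set.sdiff_eq_empty]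
    constructor
    · rintro ⟨hs, ha, hb⟩; exact ⟨hs, ha, by rwa [symmDiff_eq_sdiff_of_subset hs] at hb⟩
    · rintro ⟨hs, ha, hb⟩; exact ⟨hs, ha, by rwa [symmDiff_eq_sdiff_of_subset hs]⟩
  have e2 : (univ.filter fun a : Set ι => a \ F = ∅ ∧ a ∈ 𝔄 ∩ 𝔅 ∧ a ∆ F ∈ (Set.univ : Set (Set ι))) =
      (subsetsOf F).filter fun a => a ∈ 𝔄 ∧ a ∈ 𝔅 := by
    ext a
    simp only [mem_filter, mem_univ, true_and, mem_subsetsOf, Set.sdiff_eq_empty, Set.mem_inter_iff, Set.mem_univ, and_true]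
  rw [e1, e2] at h
  unfold klCube
  have h' := Int.ofNat_le.2 h
  linarith

/-- **The singleton lemma**: if `∅ ∉ 𝔄`, `∅ ∉ 𝔅` and some singleton `{t} ∈ 𝔄 ∩ 𝔅` with `t ∈ F`, then `klCube 𝔄 𝔅 F ≥ 1`
(indeed `klCube = #{a ⊆ F \ {t} : a ∉ 𝔄, a ∉ 𝔅}`, which contains `∅`). [this work] -/
theorem one_le_klCube {𝔄 𝔅 : Set (Set ι)} (h𝔄 : IsUpperSet 𝔄) (h𝔅 : IsUpperSet 𝔅) (h0A : (∅ : Set ι) ∉ 𝔄)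
    (h0B : (∅ : Set ι) ∉ 𝔅) {F : Set ι} {t : ι} (ht : t ∈ F) (htA : ({t} : Set ι) ∈ 𝔄) (htB : ({t} : Set ι) ∈ 𝔅) :
    1 ≤ klCube 𝔄 𝔅 F := by
  -- the sub-cube without `t`
  set F' : Set ι := F \ {t} with hF'
  have hsub : ∀ a : Set ι, t ∈ a → a ∈ 𝔄 ∧ a ∈ 𝔅 := fun a hta =>
    ⟨h𝔄 (Set.singleton_subset_iff.2 hta) htA, h𝔅 (Set.singleton_subset_iff.2 hta) htB⟩
  -- X = {a ⊆ F : a ∈ 𝔄 ∩ 𝔅} splits by `t ∈ a`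
  set X := (subsetsOf F).filter fun a => a ∈ 𝔄 ∧ a ∈ 𝔅 with hX
  set Y := (subsetsOf F).filter fun a => a ∈ 𝔄 ∧ F \ a ∈ 𝔅 with hY
  set a₀ := (subsetsOf F').filter fun a => a ∈ 𝔄 with ha₀
  set b₀ := (subsetsOf F').filter fun a => a ∈ 𝔅 with hb₀
  -- |X| = |subsetsOf F'| + |a₀ ∩ b₀|
  have cX : X.card = (subsetsOf F').card + (a₀ ∩ b₀).card := by
    rw [← card_filter_add_card_filter_not (s := X) (fun a => t ∈ a)]
    congr 1
    · -- {a ∈ X : t ∈ a} ≃ subsetsOf F' via a ↦ a \ {t}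
      refine card_bij' (fun a _ => a \ {t}) (fun b _ => insert t b) ?_ ?_ ?_ ?_
      · intro a ha
        simp only [hX, mem_filter, mem_subsetsOf] at ha
        rw [mem_subsetsOf]
        exact Set.sdiff_subset_sdiff_left ha.1.1
      · intro b hb
        rw [mem_subsetsOf] at hb
        simp only [hX, mem_filter, mem_subsetsOf]
        refine ⟨⟨Set.insert_subset ht (hb.trans Set.sdiff_subset), hsub _ (Set.mem_insert t b)⟩, Set.mem_insert t b⟩
      · intro a ha
        simp only [hX, mem_filter] at ha
        ext c; simp only [Set.mem_insert_iff, Set.mem_sdiff, Set.mem_singleton_iff]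
        constructor
        · rintro (rfl | ⟨h, _⟩)
          exacts [ha.2, h]
        · intro h; by_cases hc : c = t
          exacts [Or.inl hc, Or.inr ⟨h, hc⟩]
      · intro b hb
        rw [mem_subsetsOf] at hb
        have htb : t ∉ b := fun h => (hb h).2 rfl
        ext c; simp only [Set.mem_sdiff, Set.mem_insert_iff, Set.mem_singleton_iff]
        constructor
        · rintro ⟨rfl | h, hne⟩; exacts [absurd rfl hne, h]
        · intro h; exact ⟨Or.inr h, fun hc => htb (hc ▸ h)⟩
    · -- {a ∈ X : t ∉ a} = a₀ ∩ b₀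
      congr 1
      ext a
      simp only [hX, ha₀, hb₀, mem_filter, mem_inter, mem_subsetsOf, hF']
      constructor
      · rintro ⟨⟨haF, haA, haB⟩, hta⟩
        have haF' : a ⊆ F \ {t} := fun c hc => ⟨haF hc, fun h => hta (h ▸ hc)⟩
        exact ⟨⟨haF', haA⟩, haF', haB⟩
      · rintro ⟨⟨haF', haA⟩, _, haB⟩
        exact ⟨⟨haF'.trans Set.sdiff_subset, haA, haB⟩, fun h => (haF' h).2 rfl⟩
  -- |Y| = |b₀| + |a₀|
  have cY : Y.card = b₀.card + a₀.card := by
    rw [← card_filter_add_card_filter_not (s := Y) (fun a => t ∈ a)]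
    congr 1
    · -- {a ∈ Y : t ∈ a} ≃ b₀ via a ↦ F \ a
      refine card_bij' (fun a _ => F \ a) (fun b _ => F \ b) ?_ ?_ ?_ ?_
      · intro a ha
        simp only [hY, mem_filter, mem_subsetsOf] at ha
        simp only [hb₀, mem_filter, mem_subsetsOf, hF']
        exact ⟨fun c hc => ⟨hc.1, fun h => hc.2 (h ▸ ha.2)⟩, ha.1.2.2⟩
      · intro b hb
        simp only [hb₀, mem_filter, mem_subsetsOf, hF'] at hb
        simp only [hY, mem_filter, mem_subsetsOf]
        have htb : t ∉ b := fun h => (hb.1 h).2 rfl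
        have hta : t ∈ F \ b := ⟨ht, htb⟩
        have hbF : b ⊆ F := hb.1.trans Set.sdiff_subset
        refine ⟨⟨Set.sdiff_subset, (hsub _ hta).1, ?_⟩, hta⟩
        rw [Set.sdiff_sdiff_cancel_left hbF]; exact hb.2
      · intro a ha
        simp only [hY, mem_filter, mem_subsetsOf] at ha
        exact Set.sdiff_sdiff_cancel_left ha.1.1
      · intro b hb
        simp only [hb₀, mem_filter, mem_subsetsOf, hF'] at hb
        exact Set.sdiff_sdiff_cancel_left (hb.1.trans Set.sdiff_subset)
    · -- {a ∈ Y : t ∉ a} = a₀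
      congr 1
      ext a
      simp only [hY, ha₀, mem_filter, mem_subsetsOf, hF']
      constructor
      · rintro ⟨⟨haF, haA, _⟩, hta⟩
        exact ⟨fun c hc => ⟨haF hc, fun h => hta (h ▸ hc)⟩, haA⟩
      · rintro ⟨haF', haA⟩
        have hta : t ∉ a := fun h => (haF' h).2 rfl
        exact ⟨⟨haF'.trans Set.sdiff_subset, haA, (hsub (F \ a) ⟨ht, hta⟩).2⟩, hta⟩
  -- inclusion–exclusion on the cube `F'`, where `∅` is in neither family
  have hie := card_union_add_card_inter a₀ b₀
  have hlt : (a₀ ∪ b₀).card < (subsetsOf F').card := by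
    refine card_lt_card ⟨fun a ha => ?_, fun hsub' => ?_⟩
    · rcases mem_union.1 ha with ha | ha
      · exact (mem_filter.1 ha).1
      · exact (mem_filter.1 ha).1
    · have h0 : (∅ : Set ι) ∈ a₀ ∪ b₀ := hsub' (mem_subsetsOf.2 (Set.empty_subset _))
      rcases mem_union.1 h0 with h0 | h0
      · exact h0A (mem_filter.1 h0).2
      · exact h0B (mem_filter.1 h0).2
  unfold klCube
  rw [← hX, ← hY, cX, cY]
  push_cast
  have := (a₀ ∩ b₀).card
  omega

/-! ## Pattern double sums over `(P₁, P₃) = (u, a)`, `u ⊆ Q`, `a ⊆ Q \ u` -/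

/-- Integer indicator. [this work] -/
def indZ (p : Prop) : ℤ := if p then 1 else 0

omit [Fintype ι] in
/-- `indZ` of a true proposition. [this work] -/
theorem indZ_of_pos {p : Prop} (h : p) : indZ p = 1 := by unfold indZ; rw [if_pos h]
omit [Fintype ι] in
/-- `indZ` of a false proposition. [this work] -/
theorem indZ_of_neg {p : Prop} (h : ¬ p) : indZ p = 0 := by unfold indZ; rw [if_neg h]
omit [Fintype ι] in
/-- `indZ` is nonnegative. [this work] -/
theorem indZ_nonneg (p : Prop) : 0 ≤ indZ p := by unfold indZ; split_ifs <;> norm_num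
omit [Fintype ι] in
/-- `indZ` is at most one. [this work] -/
theorem indZ_le_one (p : Prop) : indZ p ≤ 1 := by unfold indZ; split_ifs <;> norm_num
omit [Fintype ι] in
/-- `indZ` of a conjunction. [this work] -/
theorem indZ_and (p q : Prop) : indZ (p ∧ q) = indZ p * indZ q := by
  unfold indZ; by_cases hp : p <;> by_cases hq : q <;> simp [hp, hq]

/-- A count as a sum of indicators. [this work] -/
theorem card_filter_eq_sum_indZ {α : Type*} (s : Finset α) (p : α → Prop) [DecidablePred p] :
    ((s.filter p).card : ℤ) = ∑ x ∈ s, indZ (p x) := by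
  rw [Finset.natCast_card_filter]
  refine Finset.sum_congr rfl fun x _ => ?_
  unfold indZ
  by_cases h : p x <;> simp [h]

/-- The PATTERN DOUBLE SUM: over the first part `u ⊆ Q` and the third part `a ⊆ Q \ u` (the second part being `(Q \ u) \ a`). [this work] -/
def patSum (Q : Set ι) (f : Set ι → Set ι → ℤ) : ℤ := ∑ u ∈ subsetsOf Q, ∑ a ∈ subsetsOf (Q \ u), f u a

omit [Fintype ι] in
/-- The third part of the pattern `(u, (Q \ u) \ a)` is `a` (for `a ⊆ Q \ u`). [this work] -/
theorem pt₃_mk {Q u a : Set ι} (ha : a ⊆ Q \ u) : pt₃ Q (u, (Q \ u) \ a) = a := by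
  unfold pt₃
  ext c; simp only [Set.mem_sdiff, Set.mem_union]
  constructor
  · rintro ⟨hQ, hn⟩
    by_contra hc
    by_cases hu : c ∈ u
    · exact hn (Or.inl hu)
    · exact hn (Or.inr ⟨⟨hQ, hu⟩, hc⟩)
  · intro hc; exact ⟨(ha hc).1, fun h => h.elim (fun hu => (ha hc).2 hu) (fun h2 => h2.2 hc)⟩

/-- **A sum over the Q-patterns is a pattern double sum** (`P ↦ (P₁, P₃)` is a bijection onto `{(u,a) : u ⊆ Q, a ⊆ Q \ u}`). [this work] -/
theorem sum_cfgsIn_eq_patSum (Q : Set ι) (g : Set ι × Set ι → ℤ) :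
    ∑ P ∈ cfgsIn Q, g P = patSum Q (fun u a => g (u, (Q \ u) \ a)) := by
  unfold patSum
  rw [← Finset.sum_sigma (subsetsOf Q) (fun u => subsetsOf (Q \ u)) (fun x => g (x.1, (Q \ x.1) \ x.2))]
  refine Finset.sum_bij' (fun P _ => ⟨P.1, pt₃ Q P⟩) (fun x _ => (x.1, (Q \ x.1) \ x.2)) ?_ ?_ ?_ ?_ ?_
  · intro P hP
    rw [mem_cfgsIn] at hP
    simp only [Finset.mem_sigma, mem_subsetsOf]
    exact ⟨hP.1, fun c hc => ⟨hc.1, fun hu => hc.2 (Or.inl hu)⟩⟩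
  · intro x hx
    simp only [Finset.mem_sigma, mem_subsetsOf] at hx
    rw [mem_cfgsIn]
    exact ⟨hx.1, Set.sdiff_subset.trans Set.sdiff_subset,
      Set.disjoint_left.2 fun c hu hc => hc.1.2 hu⟩
  · intro P hP
    rw [mem_cfgsIn] at hP
    obtain ⟨h1, h2, hd⟩ := hP
    refine Prod.ext rfl ?_
    show (Q \ P.1) \ pt₃ Q P = P.2
    unfold pt₃
    ext c; simp only [Set.mem_sdiff, Set.mem_union]
    constructor
    · rintro ⟨⟨hQ, hu⟩, hn⟩; by_contra hc; exact hn ⟨hQ, fun h => h.elim hu hc⟩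
    · intro hc; exact ⟨⟨h2 hc, fun hu => Set.disjoint_left.1 hd hu hc⟩, fun h => h.2 (Or.inr hc)⟩
  · intro x hx
    simp only [Finset.mem_sigma, mem_subsetsOf] at hx
    exact Sigma.ext rfl (heq_of_eq (pt₃_mk hx.2))
  · intro P hP
    rw [mem_cfgsIn] at hP
    obtain ⟨h1, h2, hd⟩ := hP
    congr 1
    refine Prod.ext rfl ?_
    show P.2 = (Q \ P.1) \ pt₃ Q P
    unfold pt₃
    ext c; simp only [Set.mem_sdiff, Set.mem_union]
    constructor
    · intro hc; exact ⟨⟨h2 hc, fun hu => Set.disjoint_left.1 hd hu hc⟩, fun h => h.2 (Or.inr hc)⟩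
    · rintro ⟨⟨hQ, hu⟩, hn⟩; by_contra hc; exact hn ⟨hQ, fun h => h.elim hu hc⟩

/-- **Exchanging the first and third parts** in a pattern double sum. [this work] -/
theorem patSum_comm (Q : Set ι) (f : Set ι → Set ι → ℤ) : patSum Q f = patSum Q (fun a u => f u a) := by
  unfold patSum
  rw [← Finset.sum_sigma (subsetsOf Q) (fun u => subsetsOf (Q \ u)) (fun x => f x.1 x.2),
    ← Finset.sum_sigma (subsetsOf Q) (fun a => subsetsOf (Q \ a)) (fun x => f x.2 x.1)]
  refine Finset.sum_bij' (fun x _ => ⟨x.2, x.1⟩) (fun x _ => ⟨x.2, x.1⟩) ?_ ?_ (fun _ _ => rfl) (fun _ _ => rfl) (fun _ _ => rfl)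
  · intro x hx
    simp only [Finset.mem_sigma, mem_subsetsOf] at hx ⊢
    exact ⟨hx.2.trans Set.sdiff_subset, fun c hc => ⟨hx.1 hc, fun h => (hx.2 h).2 hc⟩⟩
  · intro x hx
    simp only [Finset.mem_sigma, mem_subsetsOf] at hx ⊢
    exact ⟨hx.2.trans Set.sdiff_subset, fun c hc => ⟨hx.1 hc, fun h => (hx.2 h).2 hc⟩⟩

/-- The Kleitman slack as an inner pattern sum over the third part. [this work] -/
theorem klCube_eq_sum (𝔄 𝔅 : Set (Set ι)) (F : Set ι) :
    klCube 𝔄 𝔅 F = ∑ a ∈ subsetsOf F, (indZ (a ∈ 𝔄 ∧ a ∈ 𝔅) - indZ (a ∈ 𝔄 ∧ F \ a ∈ 𝔅)) := by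
  unfold klCube
  rw [card_filter_eq_sum_indZ, card_filter_eq_sum_indZ, Finset.sum_sub_distrib]

/-- **Reflection inside a sub-cube**: `a ↦ F \ a` is an involution of `subsetsOf F`. [this work] -/
theorem sum_subsetsOf_reflect (F : Set ι) (g : Set ι → ℤ) : ∑ a ∈ subsetsOf F, g (F \ a) = ∑ a ∈ subsetsOf F, g a := by
  refine Finset.sum_bij' (fun a _ => F \ a) (fun a _ => F \ a) ?_ ?_ ?_ ?_ (fun _ _ => rfl)
  · intro a _; rw [mem_subsetsOf]; exact Set.sdiff_subset
  · intro a _; rw [mem_subsetsOf]; exact Set.sdiff_subset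
  · intro a ha; rw [mem_subsetsOf] at ha; exact Set.sdiff_sdiff_cancel_left ha
  · intro a ha; rw [mem_subsetsOf] at ha; exact Set.sdiff_sdiff_cancel_left ha

/-! ## The discount `δ` on singletons: a chosen element in every nonempty subset of `Q` -/

/-- `δ_t = #{u ⊆ Q : u ≠ ∅ and the chosen element of u is t}` (`Set.Nonempty.some` is the choice). [this work] -/
def delta (Q : Set ι) (t : ι) : ℕ := ((subsetsOf Q).filter fun u => ∃ h : u.Nonempty, h.some = t).card

/-- **Summing the discounts**: `Σ_{t ∈ T} δ_t = #{u ⊆ Q : u ≠ ∅, chosen(u) ∈ T}`. [this work] -/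
theorem sum_delta (Q : Set ι) (T : Finset ι) :
    ∑ t ∈ T, (delta Q t : ℤ) = (((subsetsOf Q).filter fun u => ∃ h : u.Nonempty, h.some ∈ T).card : ℤ) := by
  rw [← Nat.cast_sum, Nat.cast_inj]
  by_cases hT : T = ∅
  · subst hT
    simp only [sum_empty, notMem_empty, exists_false]
    rw [eq_comm, card_eq_zero, filter_eq_empty_iff]
    intro u _ h; exact h
  obtain ⟨t₀, ht₀⟩ := nonempty_iff_ne_empty.2 hT
  set M := (subsetsOf Q).filter fun u => ∃ h : u.Nonempty, h.some ∈ T with hM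
  let f : Set ι → ι := fun u => if h : u.Nonempty then h.some else t₀
  have hmaps : ∀ u ∈ M, f u ∈ T := by
    intro u hu
    rw [hM, mem_filter] at hu
    obtain ⟨h, hh⟩ := hu.2
    simp only [f, dif_pos h]; exact hh
  rw [card_eq_sum_card_fiberwise hmaps]
  refine sum_congr rfl fun t ht => ?_
  unfold delta
  congr 1
  ext u
  constructor
  · intro hu
    rw [mem_filter] at hu
    obtain ⟨huQ, hne, hh⟩ := hu
    have hf : f u = hne.some := dif_pos hne
    rw [mem_filter, hM, mem_filter]
    exact ⟨⟨huQ, hne, by rw [hh]; exact ht⟩, by rw [hf, hh]⟩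
  · intro hu
    rw [mem_filter] at hu
    obtain ⟨huM, hfu⟩ := hu
    rw [hM, mem_filter] at huM
    obtain ⟨huQ, hne, _⟩ := huM
    rw [mem_filter]
    refine ⟨huQ, hne, ?_⟩
    have hf : f u = hne.some := dif_pos hne
    rw [← hf]; exact hfu

/-- `δ_t ≤ #{u ⊆ Q \ {t}}` (`u ↦ u \ {t}` is injective on the sets whose chosen element is `t`). [this work] -/
theorem delta_le (Q : Set ι) (t : ι) : delta Q t ≤ (subsetsOf (Q \ {t})).card := by
  unfold delta
  refine card_le_card_of_injOn (fun u => u \ {t}) (fun u hu => ?_) (fun u hu u' hu' h => ?_)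
  · rw [mem_coe, mem_filter, mem_subsetsOf] at hu
    rw [mem_coe, mem_subsetsOf]
    exact Set.sdiff_subset_sdiff_left hu.1
  · rw [mem_coe, mem_filter] at hu hu'
    obtain ⟨h1, hh1⟩ := hu.2
    obtain ⟨h2, hh2⟩ := hu'.2
    have htu : t ∈ u := hh1 ▸ h1.some_mem
    have htu' : t ∈ u' := hh2 ▸ h2.some_mem
    have h' : u \ {t} = u' \ {t} := h
    have e : insert t (u \ {t}) = insert t (u' \ {t}) := by rw [h']
    rwa [Set.insert_sdiff_singleton, Set.insert_sdiff_singleton, Set.insert_eq_of_mem htu, Set.insert_eq_of_mem htu'] at e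

/-! ## The weights: `W` (two-copy), `wdiag`/`φ` (one-copy), `μ` and `K*` (the diagonal majorant) -/

omit [Fintype ι] in
/-- The two-copy weight of the pattern with first part `u` and third part `a`: `[P₂ ≠ ∅] + [P₃ ≠ ∅] − [P₁ ≠ ∅]`. [this work] -/
def wcoef (Q u a : Set ι) : ℤ := indZ ((Q \ u) \ a).Nonempty + indZ a.Nonempty - indZ u.Nonempty

/-- **`W(𝔄,𝔅)`** `= Σ_P ([P₂≠∅]+[P₃≠∅]−[P₁≠∅])·[P₂ ∈ 𝔄]·[P₃ ∈ 𝔅]` (the `N1 + N2 − T` weight of a pair of signatures). [this work] -/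
def wPat (Q : Set ι) (𝔄 𝔅 : Set (Set ι)) : ℤ :=
  patSum Q fun u a => wcoef Q u a * (indZ ((Q \ u) \ a ∈ 𝔄) * indZ (a ∈ 𝔅))

/-- The one-copy weight of a third part `a`: `Σ_{u ⊆ Q \ a} (2[a ≠ ∅] − [u ≠ ∅])` (`= 2^{|Q∖a|}+1` for `a ≠ ∅`, `= −(2^{|Q|}−1)`
for `a = ∅`: units `a,b` minus `N3`). [this work] -/
def wdiag (Q a : Set ι) : ℤ := ∑ u ∈ subsetsOf (Q \ a), (2 * indZ a.Nonempty - indZ u.Nonempty)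

/-- **`φ(𝔇)`** `= Σ_{a ⊆ Q, a ∈ 𝔇} wdiag a` (the one-copy budget of a signature `𝔇 = 𝔄 ∩ 𝔅`). [this work] -/
def phiPat (Q : Set ι) (𝔇 : Set (Set ι)) : ℤ := ∑ a ∈ subsetsOf Q, indZ (a ∈ 𝔇) * wdiag Q a

/-- **`μ(a)`** `= wdiag a − [a = {t}]·δ_t`: the one-copy weight with the negative weight of `∅` redistributed over the singletons. [this work] -/
def mu (Q a : Set ι) : ℤ := wdiag Q a - ∑ t ∈ univ.filter (fun t : ι => a = {t}), (delta Q t : ℤ)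

/-- **`K*(𝔄,𝔅)`** `= Σ_{a ⊆ Q, a ≠ ∅, a ∈ 𝔄 ∩ 𝔅} μ(a)`: the DIAGONAL MAJORANT. [this work] -/
def kStar (Q : Set ι) (𝔄 𝔅 : Set (Set ι)) : ℤ := ∑ a ∈ subsetsOf Q, indZ (a.Nonempty ∧ a ∈ 𝔄 ∧ a ∈ 𝔅) * mu Q a

/-- **`μ ≥ 0`** on nonempty parts. [this work] -/
theorem mu_nonneg (Q : Set ι) {a : Set ι} (ha : a.Nonempty) : 0 ≤ mu Q a := by
  unfold mu wdiag
  have h1 : ((subsetsOf (Q \ a)).card : ℤ) ≤ ∑ u ∈ subsetsOf (Q \ a), (2 * indZ a.Nonempty - indZ u.Nonempty) := by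
    have : ∑ _u ∈ subsetsOf (Q \ a), (1 : ℤ) = (subsetsOf (Q \ a)).card := by simp
    rw [← this]
    refine sum_le_sum fun u _ => ?_
    rw [indZ_of_pos ha]; have := indZ_le_one u.Nonempty; linarith
  -- the discount: at most one `t` with `a = {t}`, and `δ_t ≤ #subsetsOf (Q \ {t}) = #subsetsOf (Q \ a)`
  have h2 : ∑ t ∈ univ.filter (fun t : ι => a = {t}), (delta Q t : ℤ) ≤ (subsetsOf (Q \ a)).card := by
    by_cases hs : ∃ t, a = {t}
    · obtain ⟨t, rfl⟩ := hs
      have hf : univ.filter (fun t' : ι => ({t} : Set ι) = {t'}) = {t} := by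
        ext t'; simp only [mem_filter, mem_univ, true_and, mem_singleton, Set.singleton_eq_singleton_iff, eq_comm]
      rw [hf, sum_singleton]
      exact_mod_cast delta_le Q t
    · have hf : univ.filter (fun t : ι => a = {t}) = ∅ := by
        rw [filter_eq_empty_iff]; intro t _ h; exact hs ⟨t, h⟩
      rw [hf, sum_empty]; exact_mod_cast Nat.zero_le _
  linarith

end Summit.CriticalPhenomena.PercolationContinuityZ3.Theorems.ThreePartition

end
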